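import Mathlib
import Literature.AlgebraicGeometry.Resolution.BlowupStalkCharts
import Summits.ResolutionOfSingularities.ResolutionOfSingularities.Theorems.RadicialJungCleanModelsCentreBlowupChart
import Summits.ResolutionOfSingularities.ResolutionOfSingularities.Theorems.RadicialJungCleanModelsCleanProp44ChartStepTransport
import HarnessLib

/-!
# Route `RadicialJung`, crux `CleanModels` (stmt-ResolutionOfSingularities-15917), line `Sketch` rev 35, stub 6 `stub_cleanProp44` (X44c):
# THE CHART IDENTIFICATION (census (S2)), ONE STOREY ON THE TREE'S BLOWINGS UP — the storey of ✓ `…ChartStep(Transport)` read on the stalks of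
# `IsBlowup`, with the chart rings hidden (pattern of ✓ `exists_transform_normalForm_of_isBlowup`)

Seat decomp-res-hand-2 g22 (structural hand).  At a point `x′` of a blowing up `τ : X′ → X` along `J` (`IsBlowup τ J`) over `x = τ x′`, with `(c, w)` a
regular system of parameters of `𝒪_{X,x}` and `(c) = J_x` (the centre), the tree gives ONE chart presenting `𝒪_{X′,x′}` as a localization of a Rees chart
ring (✓ `IsBlowup.exists_reesChart_stalk`, Stacks 0804), and ✓ `chartQuotEquiv` identifies the chart modulo the exceptional parameter with a polynomial
ring over `𝒪_{X,x}/(c)` (Stacks 0BIQ).  Feeding this abstract chart datum to ✓ `exists_isLocalization_quot_chart` / ✓ `bijective_quotientMap_chart` /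
✓ `isLocalization_quot_chart_all` / ✓ `exists_isLocalization_quot_chart_polynomial` / ✓ `isLocalRing_quot_chart` yields, IN STALK LANGUAGE ONLY:

* `exists_chart_localization_of_isBlowup` — a chart index `i` and elements `uf_k ∈ 𝒪_{X′,x′}` with `τ♯c_k = τ♯cᵢ · uf_k`, `uf_i = 1`, and for the ideals
  `K′ = (τ♯cᵢ, uf_j : j ∈ J)` of `𝒪_{X′,x′}`:
  (loc) `𝒪_{X′,x′} ⧸ K′` is local when the `uf_j`, `j ∈ J`, are non-units;
  (Z) if ALL `uf_j` (`j ≠ i`) are non-units (`x′` on every strict transform `V(uf_j)` — along the σ-tower of memo 4e §2.5: `z_{j+1} ∈ Z_j`): every class of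
  `𝒪_{X′,x′} ⧸ (τ♯cᵢ, uf)` is a `τ♯r`, `τ♯r ∈ (τ♯cᵢ, uf) ⟹ r ∈ (c)` (so `𝒪_{X,x}/(c) ≅ 𝒪_{X′,x′}/(τ♯cᵢ, uf)`: `D_{j+1} ≅ D_j`), and «`𝒪_{X,x}/(c)` is a
  localization of `K` at `M₀`» passes to `𝒪_{X′,x′} ⧸ (τ♯cᵢ, uf)` for every compatible `K`-structure;
  (X) if `J` misses exactly one index `i₀`: «`𝒪_{X,x}/(c)` is a localization of `K`» makes `𝒪_{X′,x′} ⧸ K′` a localization of `K[X]` at some submonoid for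
  every `K[X]`-structure with `C g ↦ (class of g)`, `X ↦ uf_{i₀}` — the exceptional divisor of a curve blow-up (`n = 2`, `J = ∅`: the input of
  ✓ `isLocalizationAtPrime_span_pair_of_mem` / ✓ `exists_prime_isLocalizationAtPrime_span`, hence of ✓ `birth_descent_of_isLocalization` /
  ✓ `exists_successor_of_isLocalization`), or the line `Z_0 ⊂ E_c` of the point blow-up (`n = 3`, `J = {t}`, `K = κ(c) = 𝒪_{X,c}/𝔪_c`: the START of the
  invariant «`𝒪_{Z_0,z_1}` is a localization of `κ(c)[u]`»).

What remains of (S2) after this file: the ℕ-indexed bookkeeping of the σ-tower (census (S1): chain the levels, carrying `K = κ(c)[u]`, `M₀` and the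
compatibility of the `κ(c)[u]`-structures — each level's structure is DEFINED through the previous quotient map, so the compatibility hypotheses below
hold by construction) and the comparison with the cocone's `eval₂` structure of ✓ `tower_face` (✓ `isLocalization_of_algebraMap_eq`).  Honest framing:
OURS, instantiation only; nothing here proves X44c, any case of `CleanModels`, or resolution of singularities in characteristic `p`.
[cite: StacksProject, Tag 0804, Tag 0BIQ] [cite: Matsumura1987, Thm. 4.1–4.3, Thm. 14.2] [cite: CossartPiltant2008, Prop. 4.4 (proof, p. 11)]
-/

noncomputable section

set_option linter.dupNamespace false -- mandated namespace of this single-conjunct summit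

open IsLocalRing CategoryTheory AlgebraicGeometry
open Literature.AlgebraicGeometry.Resolution

namespace Summit.ResolutionOfSingularities.ResolutionOfSingularities.Theorems.RadicialJung.CleanModels

universe u

/-! ## §0 The storey's specialisations with the quotient ideal as a free variable (so that stalk-side ideals can be substituted) -/

section Generalized

variable {R : Type u} [CommRing R] [IsLocalRing R] {n : ℕ} (c : Fin n → R) (i : Fin n)
  {A : Type u} [CommRing A] (L : Type u) [CommRing L] (ψ : R →+* A) (u : Fin n → A)
  (ε : MvPolynomial {j : Fin n // j ≠ i} (R ⧸ Ideal.span (Set.range c)) ≃+* A ⧸ Ideal.span {ψ (c i)})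
  (hεC : ∀ r : R, ε (MvPolynomial.C (Ideal.Quotient.mk (Ideal.span (Set.range c)) r)) = Ideal.Quotient.mk _ (ψ r))
  (hεX : ∀ j : {j : Fin n // j ≠ i}, ε (MvPolynomial.X j) = Ideal.Quotient.mk _ (u j.1))
  (𝔓 : Ideal A) [𝔓.IsPrime] (h𝔓 : 𝔓.comap ψ = maximalIdeal R) [Algebra A L] [IsLocalization.AtPrime L 𝔓]
  (hu : ∀ j, ψ (c j) = ψ (c i) * u j) (hci : c i ∈ maximalIdeal R)
  (sJ : Set {j : Fin n // j ≠ i}) (KL : Ideal L)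
  (hKL : KL = (Ideal.span {ψ (c i)} ⊔ Ideal.span ((fun j : {j : Fin n // j ≠ i} => u j.1) '' sJ)).map (algebraMap A L))

include h𝔓 hci hKL in
/-- ✓ `isLocalRing_quot_chart` with the quotient ideal as a variable. [folklore] -/
theorem isLocalRing_quot_chart' (hJ : ∀ j ∈ sJ, u j.1 ∈ 𝔓) : IsLocalRing (L ⧸ KL) := by
  subst hKL
  exact isLocalRing_quot_chart c i L ψ u 𝔓 sJ _ rfl h𝔓 hci hJ

include hεC hεX h𝔓 hu hci hKL in
/-- ✓ `bijective_quotientMap_chart` / ✓ `isLocalization_quot_chart_all` with the quotient ideal as a variable and the compatibility read on representatives: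
`J = all` ⟹ every class of `L ⧸ KL` is an `ψ(r)`, `ψ(r) ∈ KL ⟹ r ∈ I`, and the `K`-localization invariant passes. [cite: StacksProject, Tag 0BIQ] -/
theorem quot_chart_all' (hsJ : sJ = Set.univ) (hall : ∀ j : {j : Fin n // j ≠ i}, u j.1 ∈ 𝔓) :
    (∀ q : L ⧸ KL, ∃ r : R, Ideal.Quotient.mk KL (algebraMap A L (ψ r)) = q) ∧
    (∀ r : R, algebraMap A L (ψ r) ∈ KL → r ∈ Ideal.span (Set.range c)) ∧
    (∀ (K : Type u) [CommRing K] [Algebra K (R ⧸ Ideal.span (Set.range c))] (M₀ : Submonoid K)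
      [IsLocalization M₀ (R ⧸ Ideal.span (Set.range c))] [Algebra K (L ⧸ KL)],
      (∀ (g : K) (r : R), Ideal.Quotient.mk _ r = algebraMap K (R ⧸ Ideal.span (Set.range c)) g →
        algebraMap K (L ⧸ KL) g = Ideal.Quotient.mk KL (algebraMap A L (ψ r))) →
      IsLocalization M₀ (L ⧸ KL)) := by
  subst hsJ
  subst hKL
  have hbij := bijective_quotientMap_chart c i L ψ u ε hεC hεX 𝔓 h𝔓 _ rfl hall hci hu
  have hqm : ∀ r : R, Ideal.quotientMap _ ((algebraMap A L).comp ψ)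
      (span_range_le_comap_chartIdeal c i L ψ u Set.univ _ rfl hu) (Ideal.Quotient.mk _ r) = Ideal.Quotient.mk _ (algebraMap A L (ψ r)) :=
    fun r => rfl
  refine ⟨fun q => ?_, fun r hr => ?_, fun K _ _ M₀ _ _ huser => ?_⟩
  · obtain ⟨d, hd⟩ := hbij.2 q
    obtain ⟨r, rfl⟩ := Ideal.Quotient.mk_surjective d
    exact ⟨r, by rw [← hqm, hd]⟩
  · have h0 : Ideal.quotientMap _ ((algebraMap A L).comp ψ) (span_range_le_comap_chartIdeal c i L ψ u Set.univ _ rfl hu) (Ideal.Quotient.mk _ r) = 0 := by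
      rw [hqm, Ideal.Quotient.eq_zero_iff_mem]; exact hr
    exact Ideal.Quotient.eq_zero_iff_mem.mp ((injective_iff_map_eq_zero _).mp hbij.1 _ h0)
  · refine isLocalization_quot_chart_all c i L ψ u ε hεC hεX 𝔓 h𝔓 _ rfl hall hci hu M₀ (fun g => ?_)
    obtain ⟨r, hr⟩ := Ideal.Quotient.mk_surjective (algebraMap K (R ⧸ Ideal.span (Set.range c)) g)
    rw [← hr, hqm]
    exact huser g r hr

include hεC hεX 𝔓 hu hKL in
omit [IsLocalRing R] in
/-- ✓ `exists_isLocalization_quot_chart_polynomial` with the quotient ideal as a variable and the compatibility read on representatives. [cite: StacksProject, Tag 0BIQ] -/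
theorem exists_isLocalization_quot_chart_polynomial' (i₀ : {j : Fin n // j ≠ i}) (hi₀ : i₀ ∉ sJ)
    (huniq : ∀ j : {j : Fin n // j ≠ i}, j ∉ sJ → j = i₀)
    {K : Type*} [CommRing K] [Algebra K (R ⧸ Ideal.span (Set.range c))] (M₀ : Submonoid K) [IsLocalization M₀ (R ⧸ Ideal.span (Set.range c))]
    [Algebra (Polynomial K) (L ⧸ KL)]
    (hKC : ∀ (g : K) (r : R), Ideal.Quotient.mk _ r = algebraMap K (R ⧸ Ideal.span (Set.range c)) g →
      algebraMap (Polynomial K) (L ⧸ KL) (Polynomial.C g) = Ideal.Quotient.mk KL (algebraMap A L (ψ r)))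
    (hKX : algebraMap (Polynomial K) (L ⧸ KL) Polynomial.X = Ideal.Quotient.mk KL (algebraMap A L (u i₀.1))) :
    ∃ N : Submonoid (Polynomial K), IsLocalization N (L ⧸ KL) := by
  subst hKL
  have hqm : ∀ r : R, Ideal.quotientMap _ ((algebraMap A L).comp ψ)
      (span_range_le_comap_chartIdeal c i L ψ u sJ _ rfl hu) (Ideal.Quotient.mk _ r) = Ideal.Quotient.mk _ (algebraMap A L (ψ r)) :=
    fun r => rfl
  refine exists_isLocalization_quot_chart_polynomial c i L ψ u ε hεC hεX 𝔓 sJ _ rfl hu i₀ hi₀ huniq M₀ (fun g => ?_) hKX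
  obtain ⟨r, hr⟩ := Ideal.Quotient.mk_surjective (algebraMap K (R ⧸ Ideal.span (Set.range c)) g)
  rw [← hr, hqm]
  exact hKC g r hr

end Generalized

/-! ## §1 On the stalks of a blowing up -/

set_option maxHeartbeats 800000 in
-- the Rees chart rings elaborate large terms (as in ✓ `exists_transform_normalForm_of_isBlowup`)
/-- **One storey of the chart identification on the stalks of a blowing up.**  See the module docstring for (loc), (Z), (X).
[cite: StacksProject, Tag 0804, Tag 0BIQ] [cite: Matsumura1987, Thm. 4.1–4.3] -/
theorem exists_chart_localization_of_isBlowup {X X' : Scheme.{u}} {τ : X' ⟶ X} {J : X.IdealSheafData} (hτ : IsBlowup τ J) (x' : X')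
    (hR : IsRegularLocalRing (X.presheaf.stalk (τ x'))) {n l : ℕ} (c : Fin n → X.presheaf.stalk (τ x')) (w : Fin l → X.presheaf.stalk (τ x'))
    (hz : Ideal.span (Set.range (Fin.append c w)) = maximalIdeal (X.presheaf.stalk (τ x')))
    (hdim : ringKrullDim (X.presheaf.stalk (τ x')) = ((n + l : ℕ) : WithBot ℕ∞))
    (hcJ : Ideal.span (Set.range c) = stalkIdeal J (τ x')) :
    ∃ (i : Fin n) (uf : Fin n → X'.presheaf.stalk x'),
      (∀ k, (τ.stalkMap x').hom (c k) = (τ.stalkMap x').hom (c i) * uf k) ∧ uf i = 1 ∧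
      -- (loc) the quotients by the chart ideals are local rings
      (∀ (sJ : Set {j : Fin n // j ≠ i}) (K' : Ideal (X'.presheaf.stalk x')),
        K' = Ideal.span {(τ.stalkMap x').hom (c i)} ⊔ Ideal.span ((fun j : {j : Fin n // j ≠ i} => uf j.1) '' sJ) →
        (∀ j ∈ sJ, uf j.1 ∈ maximalIdeal (X'.presheaf.stalk x')) → IsLocalRing (X'.presheaf.stalk x' ⧸ K')) ∧
      -- (Z) all chart coordinates vanish: `𝒪_{X,x}/(c) ≅ 𝒪_{X',x'}/(τ♯cᵢ, uf)`, and the `K`-localization invariant passes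
      (∀ (K' : Ideal (X'.presheaf.stalk x')),
        K' = Ideal.span {(τ.stalkMap x').hom (c i)} ⊔ Ideal.span ((fun j : {j : Fin n // j ≠ i} => uf j.1) '' Set.univ) →
        (∀ j : {j : Fin n // j ≠ i}, uf j.1 ∈ maximalIdeal (X'.presheaf.stalk x')) →
        (∀ q : X'.presheaf.stalk x' ⧸ K', ∃ r, Ideal.Quotient.mk K' ((τ.stalkMap x').hom r) = q) ∧
        (∀ r, (τ.stalkMap x').hom r ∈ K' → r ∈ Ideal.span (Set.range c)) ∧
        (∀ (K : Type u) [CommRing K] [Algebra K (X.presheaf.stalk (τ x') ⧸ Ideal.span (Set.range c))] (M₀ : Submonoid K)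
          [IsLocalization M₀ (X.presheaf.stalk (τ x') ⧸ Ideal.span (Set.range c))] (inst : Algebra K (X'.presheaf.stalk x' ⧸ K')),
          (∀ (g : K) (r : X.presheaf.stalk (τ x')), Ideal.Quotient.mk _ r = algebraMap K (X.presheaf.stalk (τ x') ⧸ Ideal.span (Set.range c)) g →
            algebraMap K (X'.presheaf.stalk x' ⧸ K') g = Ideal.Quotient.mk K' ((τ.stalkMap x').hom r)) →
          IsLocalization M₀ (X'.presheaf.stalk x' ⧸ K'))) ∧
      -- (X) one free chart coordinate `i₀`: `𝒪_{X',x'}/K'` is a localization of `K[X]`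
      (∀ (sJ : Set {j : Fin n // j ≠ i}) (K' : Ideal (X'.presheaf.stalk x')),
        K' = Ideal.span {(τ.stalkMap x').hom (c i)} ⊔ Ideal.span ((fun j : {j : Fin n // j ≠ i} => uf j.1) '' sJ) →
        ∀ (i₀ : {j : Fin n // j ≠ i}), i₀ ∉ sJ → (∀ j : {j : Fin n // j ≠ i}, j ∉ sJ → j = i₀) →
        ∀ (K : Type u) [CommRing K] [Algebra K (X.presheaf.stalk (τ x') ⧸ Ideal.span (Set.range c))] (M₀ : Submonoid K)
          [IsLocalization M₀ (X.presheaf.stalk (τ x') ⧸ Ideal.span (Set.range c))] (inst : Algebra (Polynomial K) (X'.presheaf.stalk x' ⧸ K')),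
          (∀ (g : K) (r : X.presheaf.stalk (τ x')), Ideal.Quotient.mk _ r = algebraMap K (X.presheaf.stalk (τ x') ⧸ Ideal.span (Set.range c)) g →
            algebraMap (Polynomial K) (X'.presheaf.stalk x' ⧸ K') (Polynomial.C g) = Ideal.Quotient.mk K' ((τ.stalkMap x').hom r)) →
          algebraMap (Polynomial K) (X'.presheaf.stalk x' ⧸ K') Polynomial.X = Ideal.Quotient.mk K' (uf i₀.1) →
          ∃ N : Submonoid (Polynomial K), IsLocalization N (X'.presheaf.stalk x' ⧸ K')) := by
  haveI := hR
  have hd : (maximalIdeal (X.presheaf.stalk (τ x'))).spanFinrank = n + l := by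
    have h1 := IsRegularLocalRing.spanFinrank_maximalIdeal (R := X.presheaf.stalk (τ x'))
    rw [hdim] at h1
    exact_mod_cast h1
  obtain ⟨i, 𝔴, χ, hχ, hloc, hcomap⟩ := hτ.exists_reesChart_stalk x' c hcJ
  letI := χ.toAlgebra
  haveI := hloc
  -- the abstract chart datum of the Rees chart
  have hqr := isQuasiRegular_centre c w hz hd
  have hnzd := reesChartBase_mem_nonZeroDivisors (c i) (Ideal.mem_span_range_self (f := c) (x := i))
  have hrel : ∀ k, chartBase c i (c k) = chartBase c i (c i) * chartGen c i k := reesChartBase_apply_eq_mul_chartGen c i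
  have hci : c i ∈ maximalIdeal (X.presheaf.stalk (τ x')) := hz ▸ Ideal.subset_span ⟨Fin.castAdd l i, by simp⟩
  -- membership in `𝔴` is membership of the image in `𝔪_{x'}`
  have hmem : ∀ z : chartRing c i, χ z ∈ maximalIdeal (X'.presheaf.stalk x') ↔ z ∈ 𝔴.asIdeal := fun z =>
    IsLocalization.AtPrime.to_map_mem_maximal_iff (X'.presheaf.stalk x') 𝔴.asIdeal z
  have halg0 : (algebraMap (chartRing c i) (X'.presheaf.stalk x') : chartRing c i →+* X'.presheaf.stalk x') = χ :=
    RingHom.algebraMap_toAlgebra χ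
  have halg : ∀ z : chartRing c i, algebraMap (chartRing c i) (X'.presheaf.stalk x') z = χ z := fun z => by rw [halg0]
  -- the chart ideals upstairs are the extensions of the chart ideals `K₀`
  have hmap : ∀ sJ : Set {j : Fin n // j ≠ i},
      (Ideal.span {chartBase c i (c i)} ⊔ Ideal.span ((fun j : {j : Fin n // j ≠ i} => chartGen c i j.1) '' sJ)).map
        (algebraMap (chartRing c i) (X'.presheaf.stalk x') : chartRing c i →+* X'.presheaf.stalk x') =
      Ideal.span {(τ.stalkMap x').hom (c i)} ⊔ Ideal.span ((fun j : {j : Fin n // j ≠ i} => χ (chartGen c i j.1)) '' sJ) := by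
    intro sJ
    rw [Ideal.map_sup, Ideal.map_span, Ideal.map_span, Set.image_singleton, Set.image_image, halg0, hχ]
  refine ⟨i, fun k => χ (chartGen c i k), fun k => ?_, ?_, ?_, ?_, ?_⟩
  · rw [← hχ, ← hχ, ← map_mul, hrel k]
  · change χ (chartGen c i i) = 1
    rw [centreChartFrac_self c i (chartBase c i) (chartGen c i) hrel hnzd, map_one]
  · -- (loc)
    intro sJ K' hK' hJ
    exact isLocalRing_quot_chart' c i (X'.presheaf.stalk x') (chartBase c i) (chartGen c i) 𝔴.asIdeal hcomap hci sJ K'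
      (hK'.trans (hmap sJ).symm) (fun j hj => (hmem _).mp (hJ j hj))
  · -- (Z)
    intro K' hK' hall
    have hall' : ∀ j : {j : Fin n // j ≠ i}, chartGen c i j.1 ∈ 𝔴.asIdeal := fun j => (hmem _).mp (hall j)
    have h := quot_chart_all' c i (X'.presheaf.stalk x') (chartBase c i) (chartGen c i) (chartQuotEquiv c i hqr)
      (chartQuotMap_C c i) (chartQuotMap_X c i) 𝔴.asIdeal hcomap hrel hci Set.univ K' (hK'.trans (hmap Set.univ).symm) rfl hall'
    simp only [halg, hχ] at h
    exact h
  · -- (X)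
    intro sJ K' hK' i₀ hi₀ huniq K _ _ M₀ _ inst hKC hKX
    refine exists_isLocalization_quot_chart_polynomial' c i (X'.presheaf.stalk x') (chartBase c i) (chartGen c i) (chartQuotEquiv c i hqr)
      (chartQuotMap_C c i) (chartQuotMap_X c i) 𝔴.asIdeal hrel sJ K' (hK'.trans (hmap sJ).symm) i₀ hi₀ huniq M₀ (fun g r hr => ?_) ?_
    · rw [halg, hχ]; exact hKC g r hr
    · rw [halg]; exact hKX

end Summit.ResolutionOfSingularities.ResolutionOfSingularities.Theorems.RadicialJung.CleanModels

end
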